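import Mathlib
import HarnessLib
import Literature.MathematicalPhysics.QuantumFieldTheory.UnitaryCayleyChart

/-!
# LatticeQCDFlow / Scaling — exact small-ball asymptotics from a chart with distortion `→ 1`

HONEST FRAMING: exact (Metropolis-corrected) sampling algorithms for lattice gauge theory; figures of merit are
autocorrelation/cost numbers at stated couplings and volumes; no continuum-physics claim.

Venture `LatticeQCDFlow` (cell pub-lqcd), topic `Scaling`, FANOUT row 30 (lean-1) — OUR WORK, the abstract engine
behind the discharge of theory-2's hypothesis item `SmallBallAsymptotics G κ` (`Scaling/CalibratedWindowSteps.lean`)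
for `U(N)` and `SU(N)`.

**Setting.** `X` a metric space with a finite Borel measure `σ` whose closed balls have centre-independent mass
(`σ(B̄(x, ρ)) = σ(B̄(x₀, ρ))`, e.g. the Haar probability of a compact group with a left-invariant distance) and
charge every ball about `x₀`; `E` a finite-dimensional real normed space with an additive Haar measure `μ`
(`dim E = k`); a "chart" `φ : E → X`, `φ 0 = x₀`, continuous on `B̄(0, r₀)`, which for every `ε > 0` is
`(1+ε)`-Lipschitz and `(1+ε)`-co-Lipschitz on some ball `B̄(0, r_ε)` (`0 < r_ε ≤ r₀`; e.g. a map strictly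
differentiable at `0` with isometric derivative), and FILLS: `B̄(x₀, s) ⊆ φ(B̄(0, Λ₀ s))` for `0 ≤ s ≤ r₀`.

**Result** (sequel `Scaling/SmallBallChartLimit.lean`, `exists_tendsto_measure_closedBall_div_pow`):
`σ(B̄(x₀, t)) / t^k → C₀ ∈ (0, ∞)` as `t → 0⁺`; hence (`smallBall_two_sided`) for every `ε > 0` there are `r₁ > 0`
and `0 < a ≤ A ≤ (1 + ε)·a` with `a·t^k ≤ σ(B̄(x, t)) ≤ A·t^k` for all `x` and `0 < t ≤ r₁` — the literal shape of
`SmallBallAsymptotics`.  THIS FILE: the chart measure and the ball squeeze (§1–§3).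

**Proof** — the soft argument of `Literature/…/UnitaryCayleyChart` (§Limit, written there for the Cayley chart
of `U(N)`), made abstract and two-sided: pull `σ` back along the chart to a finite measure `ν` on `E`
(`exists_chartMeasure`, Lusin–Souslin); the BALL SQUEEZE `σ(B̄(x₀, δ/Λ)) ≤ ν(b̄(a, δ)) ≤ σ(B̄(x₀, Λδ))` for centres
`a` and radii `δ` below `r/(8Λ₀)` (`measure_closedBall_div_le_chartMeasure`, `chartMeasure_closedBall_le`);
Lebesgue–Besicovitch differentiation of `ν` w.r.t. `μ` at ONE density point `a` of scale `r`
(`Besicovitch.ae_tendsto_rnDeriv`) then gives `limsup g ≤ Λ^k·R_a ≤ Λ^{2k}·liminf g` for the ratio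
`g(t) = σ(B̄(x₀,t))/μ(b̄(0,t))` (`Λ = 1 + ε` the bi-Lipschitz constant at that scale), and `ε → 0` forces
`limsup g = liminf g < ∞`; positivity of the limit is the
Vitali covering lemma `VitaliFamily.measure_le_of_frequently_le` on a ball charged by `ν`.  Everything is
elementary measure theory on top of Mathlib; no definition is introduced (the chart measure is an `∃`); nothing is
cited as a fact.  Reading: Chatterjee, arXiv:1602.01222 §6/§11 (the `U(N)` computation); Gray, *Tubes* (2004)
Thm 9.12 (ball volumes of Riemannian manifolds, context only).
-/

noncomputable section

open MeasureTheory Measure Metric Filter Topology Set Function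
open Literature.MathematicalPhysics.QuantumFieldTheory.UnitaryCayley (tendsto_const_mul_nhdsGT)
open scoped ENNReal NNReal Topology

namespace Summit.Ventures.LatticeQCDFlow.Theory2.Lattice.SmallBallChart

variable {X : Type*} [MetricSpace X] {E : Type*} [NormedAddCommGroup E]

/-! ## §1. The chart measure `ν(A) = σ(φ(A ∩ B̄(0, r₀)))` -/

section ChartMeasure

variable [MeasurableSpace X] [BorelSpace X] [NormedSpace ℝ E] [FiniteDimensional ℝ E] [MeasurableSpace E]
  [BorelSpace E]

/-- **The pull-back of `σ` along the chart** exists as a finite Borel measure on `E`: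
`ν(A) = σ(φ(A ∩ B̄(0,r₀)))` for measurable `A` (Lusin–Souslin: a continuous injective map on the closed ball of a
finite-dimensional space is a measurable embedding). [folklore] -/
theorem exists_chartMeasure (σ : Measure X) [IsFiniteMeasure σ] {φ : E → X} {r₀ : ℝ}
    (hφ : ContinuousOn φ (closedBall 0 r₀)) (hinj : InjOn φ (closedBall 0 r₀)) :
    ∃ ν : Measure E, IsFiniteMeasure ν ∧
      ∀ A : Set E, MeasurableSet A → ν A = σ (φ '' (A ∩ closedBall 0 r₀)) := by
  have hemb : MeasurableEmbedding ((closedBall (0 : E) r₀).restrict φ) :=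
    hφ.measurableEmbedding isClosed_closedBall.measurableSet hinj
  refine ⟨(Measure.comap ((closedBall (0 : E) r₀).restrict φ) σ).map Subtype.val, ⟨?_⟩, fun A hA => ?_⟩
  · rw [Measure.map_apply measurable_subtype_coe MeasurableSet.univ, hemb.comap_apply]
    exact measure_lt_top _ _
  · rw [Measure.map_apply measurable_subtype_coe hA, hemb.comap_apply, Set.image_restrict]

end ChartMeasure

/-! ## §2. The ball squeeze at one scale -/

section Squeeze

variable {φ : E → X} {x₀ : X} {r₀ r Λ Λ₀ δ : ℝ} {a : E}

/-- Points of `b̄(a, δ)` lie in `b̄(0, r)` when `‖a‖ + δ ≤ r`. [folklore] -/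
theorem mem_closedBall_zero_of_mem_closedBall (har : ‖a‖ + δ ≤ r) {b : E} (hb : b ∈ closedBall a δ) :
    b ∈ closedBall (0 : E) r := by
  rw [mem_closedBall, dist_eq_norm] at hb
  rw [mem_closedBall, dist_zero_right]
  calc ‖b‖ = ‖(b - a) + a‖ := by rw [sub_add_cancel]
    _ ≤ ‖b - a‖ + ‖a‖ := norm_add_le _ _
    _ ≤ r := by linarith

/-- **Upper inclusion**: a `Λ`-Lipschitz chart maps `b̄(a, δ)` into `B̄(φ a, Λδ)` (`‖a‖ + δ ≤ r`). [folklore] -/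
theorem image_closedBall_subset (hΛ : 0 ≤ Λ)
    (hlip : ∀ a ∈ closedBall (0 : E) r, ∀ b ∈ closedBall (0 : E) r, dist (φ a) (φ b) ≤ Λ * ‖a - b‖)
    (hδ : 0 ≤ δ) (har : ‖a‖ + δ ≤ r) :
    φ '' (closedBall a δ ∩ closedBall 0 r₀) ⊆ closedBall (φ a) (Λ * δ) := by
  rintro _ ⟨b, ⟨hb, -⟩, rfl⟩
  have ha : a ∈ closedBall (0 : E) r := by
    rw [mem_closedBall, dist_zero_right]; linarith
  have hb' : b ∈ closedBall (0 : E) r := mem_closedBall_zero_of_mem_closedBall har hb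
  rw [mem_closedBall, dist_eq_norm, ← norm_sub_rev] at hb
  rw [mem_closedBall, dist_comm]
  calc dist (φ a) (φ b) ≤ Λ * ‖a - b‖ := hlip a ha b hb'
    _ ≤ Λ * δ := mul_le_mul_of_nonneg_left hb hΛ

/-- **Lower inclusion**: if the chart is `Λ`-Lipschitz and `Λ`-co-Lipschitz on `b̄(0, r)` (`1 ≤ Λ ≤ 2`) and fills
`B̄(x₀, s) ⊆ φ(b̄(0, Λ₀ s))` (`0 ≤ s ≤ r₀`, `1 ≤ Λ₀`), then `B̄(φ a, δ/Λ) ⊆ φ(b̄(a, δ) ∩ b̄(0, r₀))` for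
`‖a‖, δ ≤ r/(8Λ₀)`, `0 < r ≤ r₀`. [folklore] -/
theorem closedBall_subset_image (hφ0 : φ 0 = x₀)
    (hlip : ∀ a ∈ closedBall (0 : E) r, ∀ b ∈ closedBall (0 : E) r, dist (φ a) (φ b) ≤ Λ * ‖a - b‖)
    (hco : ∀ a ∈ closedBall (0 : E) r, ∀ b ∈ closedBall (0 : E) r, ‖a - b‖ ≤ Λ * dist (φ a) (φ b))
    (hfill : ∀ s : ℝ, 0 ≤ s → s ≤ r₀ → closedBall x₀ s ⊆ φ '' closedBall 0 (Λ₀ * s))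
    (hΛ : 1 ≤ Λ) (hΛ2 : Λ ≤ 2) (hΛ₀ : 1 ≤ Λ₀) (hr : 0 < r) (hrr₀ : r ≤ r₀)
    (ha : ‖a‖ ≤ r / (8 * Λ₀)) (hδ : 0 ≤ δ) (hδr : δ ≤ r / (8 * Λ₀)) :
    closedBall (φ a) (δ / Λ) ⊆ φ '' (closedBall a δ ∩ closedBall 0 r₀) := by
  intro g hg
  rw [mem_closedBall] at hg
  have hΛ₀0 : 0 < Λ₀ := by linarith
  have h8 : r / (8 * Λ₀) ≤ r / 8 := by
    apply div_le_div_of_nonneg_left hr.le (by norm_num) (by linarith)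
  have ha0 : a ∈ closedBall (0 : E) r := by
    rw [mem_closedBall, dist_zero_right]; linarith
  have h0 : (0 : E) ∈ closedBall (0 : E) r := mem_closedBall_self hr.le
  have h1 : dist (φ a) x₀ ≤ Λ * ‖a‖ := by
    have := hlip a ha0 0 h0
    rwa [hφ0, sub_zero] at this
  have hδΛ : δ / Λ ≤ δ := div_le_self hδ hΛ
  set s := δ / Λ + Λ * ‖a‖ with hs
  have hs0 : 0 ≤ s := by positivity
  have hgs : g ∈ closedBall x₀ s := by
    rw [mem_closedBall]
    calc dist g x₀ ≤ dist g (φ a) + dist (φ a) x₀ := dist_triangle _ _ _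
      _ ≤ s := add_le_add hg h1
  have hs3 : Λ₀ * s ≤ 3 * r / 8 := by
    have h2 : Λ * ‖a‖ ≤ 2 * (r / (8 * Λ₀)) := by
      calc Λ * ‖a‖ ≤ 2 * ‖a‖ := mul_le_mul_of_nonneg_right hΛ2 (norm_nonneg a)
        _ ≤ 2 * (r / (8 * Λ₀)) := by linarith
    have h3 : s ≤ 3 * (r / (8 * Λ₀)) := by linarith
    calc Λ₀ * s ≤ Λ₀ * (3 * (r / (8 * Λ₀))) := mul_le_mul_of_nonneg_left h3 hΛ₀0.le
      _ = 3 * r / 8 := by field_simp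
  have hsr₀ : s ≤ r₀ := by
    have : s ≤ Λ₀ * s := le_mul_of_one_le_left hs0 hΛ₀
    linarith
  obtain ⟨b, hb, hbg⟩ := hfill s hs0 hsr₀ hgs
  rw [mem_closedBall, dist_zero_right] at hb
  have hb' : b ∈ closedBall (0 : E) r := by
    rw [mem_closedBall, dist_zero_right]; linarith
  refine ⟨b, ⟨?_, ?_⟩, hbg⟩
  · rw [mem_closedBall, dist_eq_norm]
    calc ‖b - a‖ ≤ Λ * dist (φ b) (φ a) := hco b hb' a ha0
      _ = Λ * dist g (φ a) := by rw [hbg]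
      _ ≤ Λ * (δ / Λ) := mul_le_mul_of_nonneg_left hg (by linarith)
      _ = δ := mul_div_cancel₀ δ (by linarith)
  · rw [mem_closedBall, dist_zero_right]; linarith

end Squeeze

/-! ## §3. The squeeze in measure, and the ratio inequalities -/

section Ratio

variable [MeasurableSpace X] [NormedSpace ℝ E] [FiniteDimensional ℝ E] [MeasurableSpace E]
  [BorelSpace E] {σ : Measure X} {μ : Measure E} [μ.IsAddHaarMeasure] {ν : Measure E}
  {φ : E → X} {x₀ : X} {r₀ r Λ Λ₀ δ : ℝ} {a : E}

omit [NormedSpace ℝ E] [FiniteDimensional ℝ E] [μ.IsAddHaarMeasure] in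
/-- **Ball squeeze, upper half**: `ν(b̄(a, δ)) ≤ σ(B̄(x₀, Λδ))` (`‖a‖ + δ ≤ r`, balls of `σ` centre-free).
[folklore] -/
theorem chartMeasure_closedBall_le (hν : ∀ A : Set E, MeasurableSet A → ν A = σ (φ '' (A ∩ closedBall 0 r₀)))
    (hball : ∀ (x : X) (ρ : ℝ), σ (closedBall x ρ) = σ (closedBall x₀ ρ)) (hΛ : 0 ≤ Λ)
    (hlip : ∀ a ∈ closedBall (0 : E) r, ∀ b ∈ closedBall (0 : E) r, dist (φ a) (φ b) ≤ Λ * ‖a - b‖)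
    (hδ : 0 ≤ δ) (har : ‖a‖ + δ ≤ r) :
    ν (closedBall a δ) ≤ σ (closedBall x₀ (Λ * δ)) := by
  rw [hν _ isClosed_closedBall.measurableSet, ← hball (φ a)]
  exact measure_mono (image_closedBall_subset hΛ hlip hδ har)

omit [NormedSpace ℝ E] [FiniteDimensional ℝ E] [μ.IsAddHaarMeasure] in
/-- **Ball squeeze, lower half**: `σ(B̄(x₀, δ/Λ)) ≤ ν(b̄(a, δ))` for `‖a‖, δ ≤ r/(8Λ₀)`, `0 < r ≤ r₀`.
[folklore] -/
theorem measure_closedBall_le_chartMeasure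
    (hν : ∀ A : Set E, MeasurableSet A → ν A = σ (φ '' (A ∩ closedBall 0 r₀)))
    (hball : ∀ (x : X) (ρ : ℝ), σ (closedBall x ρ) = σ (closedBall x₀ ρ)) (hφ0 : φ 0 = x₀)
    (hlip : ∀ a ∈ closedBall (0 : E) r, ∀ b ∈ closedBall (0 : E) r, dist (φ a) (φ b) ≤ Λ * ‖a - b‖)
    (hco : ∀ a ∈ closedBall (0 : E) r, ∀ b ∈ closedBall (0 : E) r, ‖a - b‖ ≤ Λ * dist (φ a) (φ b))
    (hfill : ∀ s : ℝ, 0 ≤ s → s ≤ r₀ → closedBall x₀ s ⊆ φ '' closedBall 0 (Λ₀ * s))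
    (hΛ : 1 ≤ Λ) (hΛ2 : Λ ≤ 2) (hΛ₀ : 1 ≤ Λ₀) (hr : 0 < r) (hrr₀ : r ≤ r₀)
    (ha : ‖a‖ ≤ r / (8 * Λ₀)) (hδ : 0 ≤ δ) (hδr : δ ≤ r / (8 * Λ₀)) :
    σ (closedBall x₀ (δ / Λ)) ≤ ν (closedBall a δ) := by
  rw [hν _ isClosed_closedBall.measurableSet, ← hball (φ a)]
  exact measure_mono (closedBall_subset_image hφ0 hlip hco hfill hΛ hΛ2 hΛ₀ hr hrr₀ ha hδ hδr)

/-- Scaling of additive-Haar balls: `μ(b̄(a, cδ)) = c^{dim E}·μ(b̄(a, δ))`. [folklore] -/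
theorem addHaar_closedBall_mul (μ : Measure E) [μ.IsAddHaarMeasure] (a : E) {c δ : ℝ} (hc : 0 < c)
    (hδ : 0 ≤ δ) :
    μ (closedBall a (c * δ)) = ENNReal.ofReal (c ^ Module.finrank ℝ E) * μ (closedBall a δ) := by
  rw [Measure.addHaar_closedBall' μ a (by positivity), Measure.addHaar_closedBall' μ a hδ, mul_pow,
    ENNReal.ofReal_mul (by positivity), mul_assoc]

/-- `Ratio(a, δ) ≤ Λ^{dim E}·g(Λδ)`, where `Ratio(a, δ) = ν(b̄(a,δ))/μ(b̄(a,δ))` and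
`g(t) = σ(B̄(x₀,t))/μ(b̄(0,t))` (`‖a‖ + δ ≤ r`, `0 < δ`, `1 ≤ Λ`). [folklore] -/
theorem ratio_le (hν : ∀ A : Set E, MeasurableSet A → ν A = σ (φ '' (A ∩ closedBall 0 r₀)))
    (hball : ∀ (x : X) (ρ : ℝ), σ (closedBall x ρ) = σ (closedBall x₀ ρ)) (hΛ : 1 ≤ Λ)
    (hlip : ∀ a ∈ closedBall (0 : E) r, ∀ b ∈ closedBall (0 : E) r, dist (φ a) (φ b) ≤ Λ * ‖a - b‖)
    (hδ : 0 < δ) (har : ‖a‖ + δ ≤ r) :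
    ν (closedBall a δ) / μ (closedBall a δ) ≤ ENNReal.ofReal (Λ ^ Module.finrank ℝ E) *
      (σ (closedBall x₀ (Λ * δ)) / μ (closedBall (0 : E) (Λ * δ))) := by
  have hΛ0 : 0 < Λ := by linarith
  have hK0 : ENNReal.ofReal (Λ ^ Module.finrank ℝ E) ≠ 0 := by
    rw [ENNReal.ofReal_ne_zero_iff]; positivity
  have h := chartMeasure_closedBall_le hν hball hΛ0.le hlip hδ.le har
  rw [← Measure.addHaar_closedBall_center μ a (Λ * δ), addHaar_closedBall_mul μ a hΛ0 hδ.le,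
    ← mul_div_assoc, ENNReal.mul_div_mul_left _ _ hK0 ENNReal.ofReal_ne_top]
  exact ENNReal.div_le_div_right h _

/-- `g(t) ≤ Λ^{dim E}·Ratio(a, Λt)` for `‖a‖ ≤ r/(8Λ₀)`, `Λt ≤ r/(8Λ₀)`, `0 < t`. [folklore] -/
theorem measureRatio_le (hν : ∀ A : Set E, MeasurableSet A → ν A = σ (φ '' (A ∩ closedBall 0 r₀)))
    (hball : ∀ (x : X) (ρ : ℝ), σ (closedBall x ρ) = σ (closedBall x₀ ρ)) (hφ0 : φ 0 = x₀)
    (hlip : ∀ a ∈ closedBall (0 : E) r, ∀ b ∈ closedBall (0 : E) r, dist (φ a) (φ b) ≤ Λ * ‖a - b‖)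
    (hco : ∀ a ∈ closedBall (0 : E) r, ∀ b ∈ closedBall (0 : E) r, ‖a - b‖ ≤ Λ * dist (φ a) (φ b))
    (hfill : ∀ s : ℝ, 0 ≤ s → s ≤ r₀ → closedBall x₀ s ⊆ φ '' closedBall 0 (Λ₀ * s))
    (hΛ : 1 ≤ Λ) (hΛ2 : Λ ≤ 2) (hΛ₀ : 1 ≤ Λ₀) (hr : 0 < r) (hrr₀ : r ≤ r₀)
    (ha : ‖a‖ ≤ r / (8 * Λ₀)) {t : ℝ} (ht : 0 < t) (htr : Λ * t ≤ r / (8 * Λ₀)) :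
    σ (closedBall x₀ t) / μ (closedBall (0 : E) t) ≤ ENNReal.ofReal (Λ ^ Module.finrank ℝ E) *
      (ν (closedBall a (Λ * t)) / μ (closedBall a (Λ * t))) := by
  have hΛ0 : 0 < Λ := by linarith
  have hK0 : ENNReal.ofReal (Λ ^ Module.finrank ℝ E) ≠ 0 := by
    rw [ENNReal.ofReal_ne_zero_iff]; positivity
  have h := measure_closedBall_le_chartMeasure hν hball hφ0 hlip hco hfill hΛ hΛ2 hΛ₀ hr hrr₀ ha
    (by positivity : 0 ≤ Λ * t) htr
  rw [mul_div_cancel_left₀ t hΛ0.ne'] at h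
  rw [← Measure.addHaar_closedBall_center μ a t, addHaar_closedBall_mul μ a hΛ0 ht.le,
    ← mul_div_assoc, ENNReal.mul_div_mul_left _ _ hK0 ENNReal.ofReal_ne_top]
  exact ENNReal.div_le_div_right h _

/-- Almost every point (for `μ`) is a density point of `ν` with finite derivative; balls of positive `μ`-measure
contain such points. [folklore] -/
theorem exists_good_point (μ : Measure E) [μ.IsAddHaarMeasure] (ν : Measure E) [IsFiniteMeasure ν] {ρ : ℝ}
    (hρ : 0 < ρ) :
    ∃ a : E, ‖a‖ ≤ ρ ∧ ∃ R : ℝ≥0∞, R < ∞ ∧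
      Tendsto (fun δ => ν (closedBall a δ) / μ (closedBall a δ)) (𝓝[>] 0) (𝓝 R) := by
  have h1 := Besicovitch.ae_tendsto_rnDeriv ν μ
  have h2 := Measure.rnDeriv_lt_top ν μ
  have h := h1.and h2
  by_contra hcon
  push Not at hcon
  have hsub : closedBall (0 : E) ρ ⊆ {a | ¬ (Tendsto (fun δ => ν (closedBall a δ) / μ (closedBall a δ))
      (𝓝[>] 0) (𝓝 (ν.rnDeriv μ a)) ∧ ν.rnDeriv μ a < ∞)} := by
    intro a ha
    rw [mem_closedBall, dist_zero_right] at ha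
    rintro ⟨hT, hF⟩
    exact hcon a ha _ hF hT
  have h0 : μ (closedBall (0 : E) ρ) = 0 := measure_mono_null hsub (ae_iff.1 h)
  exact absurd h0 (Metric.measure_closedBall_pos μ 0 hρ).ne'

end Ratio


end Summit.Ventures.LatticeQCDFlow.Theory2.Lattice.SmallBallChart

end
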